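import Mathlib
import HarnessLib

/-!
# Lens 5 (g9) — two small kernel pieces for §3/§5 of THEOREM T (memo `CLASSBC-prank2-toric-lens5-g9.md` §12, rows «§3 (IND)» and «§5»)

Crux workfile on stmt-ResolutionOfSingularities-0549 (`DescentPerfectToAll`), lineage res-B-lens-5, generation g9.
bears_on: LADDER-RESOLUTION:B · [OURS · CANDIDATE] counted 0; nothing here proves resolution in char p; resolution in char p NOT proved.
Mathlib-only, def-free, port-ready (copy verbatim; the `Cruxes` tree is not built on the farm).

* `pow_ne_of_mem_maximalIdeal_of_not_mem_sq` — §5: a regular parameter `ψ ∈ 𝔪 ∖ 𝔪²` of a local domain `S ⊆ K` integrally closed in `K`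
  is not a `p`-th power in `K` (`2 ≤ p`).  With `ψ ∈ M = K^p(g₀)` written `ψ = Σ_{j<p} c_j^p g₀^j`
  (`Lens5_ImmediateValues.mem_adjoin_pthPowers_iff`) this gives the non-triviality clause `∃ j ≠ 0, c_j ≠ 0` of `CleanLUConcl` form (3)
  with `c′ = 0`.
* `valuation_pow_left_injective`, `not_dvd_exponents_of_pRankTwo` — §3 (IND): if `x^p = α·Π s_i^{A_i}`, `y^p = β·Π s_i^{B_i}` with
  `v(α) = v(β) = 1`, every non-zero element of the subfield `M ∋ s_i` has a `p`-th-power value ((V), `Lens5_ImmediateValues`), and (P2) holds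
  for `(x, y)`, then for `(a, b) ∈ [0,p)² ∖ {(0,0)}` the exponent vector `aA + bB` is NOT divisible by `p` — i.e. `A, B` are independent
  mod `p`, so the exponent lattice `Λ′ = ℤ³ + ℤA/p + ℤB/p` has index `p²` (memo §3, first paragraph).
-/

set_option linter.dupNamespace false

namespace Summit.ResolutionOfSingularities.ResolutionOfSingularities.Cruxes.DescentPerfectToAll.CpSibling.PunchlineBits

/-- §5: in a local domain `S ⊆ K` which is integrally closed in the field `K`, an element of `𝔪_S ∖ 𝔪_S²` is not a `p`-th power
in `K` for `p ≥ 2`. -/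
theorem pow_ne_of_mem_maximalIdeal_of_not_mem_sq {K : Type} [Field K] (S : Subring K) [IsLocalRing S]
    (hic : ∀ w : K, IsIntegral S w → w ∈ S) {p : ℕ} (hp : 2 ≤ p) (ψ : S)
    (h1 : ψ ∈ IsLocalRing.maximalIdeal S) (h2 : ψ ∉ (IsLocalRing.maximalIdeal S) ^ 2) :
    ∀ w : K, w ^ p ≠ (ψ : K) := by
  intro w hw
  have hp0 : 0 < p := by omega
  -- `w` is integral over `S` (root of `X^p - ψ`), hence in `S`
  have hint : IsIntegral S w := by
    apply IsIntegral.of_pow hp0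
    rw [hw]
    exact isIntegral_algebraMap (R := S) (x := ψ)
  have hwS : w ∈ S := hic w hint
  set y : S := ⟨w, hwS⟩ with hy
  have hyp : y ^ p = ψ := by
    apply Subtype.ext
    simp [hy, hw]
  -- `y ∈ 𝔪`: otherwise `ψ = y^p` is a unit
  have hym : y ∈ IsLocalRing.maximalIdeal S := by
    by_contra hcontra
    have hyu : IsUnit y := by
      simpa [IsLocalRing.mem_maximalIdeal, mem_nonunits_iff] using hcontra
    have hψu : IsUnit ψ := by rw [← hyp]; exact hyu.pow p
    exact (IsLocalRing.mem_maximalIdeal _ |>.mp h1) hψu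
  -- then `ψ = y^p ∈ 𝔪^p ⊆ 𝔪²`
  apply h2
  rw [← hyp]
  exact Ideal.pow_le_pow_right hp (Ideal.pow_mem_pow hym p)

/-- `t ↦ t ^ p` is injective on a linearly ordered commutative group with zero (`p ≠ 0`); used to take `p`-th roots of values. -/
theorem pow_left_injective_of_ne_zero {Γ₀ : Type} [LinearOrderedCommGroupWithZero Γ₀] {p : ℕ} (hp : p ≠ 0)
    {a b : Γ₀} (h : a ^ p = b ^ p) : a = b := by
  rcases lt_trichotomy a b with hab | hab | hab
  · exact absurd h (ne_of_lt (pow_lt_pow_left₀ hab zero_le hp))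
  · exact hab
  · exact absurd h.symm (ne_of_lt (pow_lt_pow_left₀ hab zero_le hp))

/-- §3 (IND): under (P2) for `(x, y)` and (V) for the subfield `M ∋ s_i`, monomial relations `x^p = α Π s_i^{A_i}`,
`y^p = β Π s_i^{B_i}` with value-one coefficients have exponent vectors `A, B` independent modulo `p`. -/
theorem not_dvd_exponents_of_pRankTwo {K : Type} [Field K] {Γ₀ : Type} [LinearOrderedCommGroupWithZero Γ₀]
    (v : Valuation K Γ₀) {p : ℕ} (hp : p ≠ 0) (M : Subfield K)
    (hV : ∀ m : K, m ∈ M → m ≠ 0 → ∃ z : K, z ≠ 0 ∧ v m = v (z ^ p))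
    {ι : Type} [Fintype ι] (s : ι → K) (hsM : ∀ i, s i ∈ M) (hs0 : ∀ i, s i ≠ 0)
    (x y α β : K) (hα : v α = 1) (hβ : v β = 1) (A B : ι → ℕ)
    (hx : x ^ p = α * ∏ i, s i ^ A i) (hy : y ^ p = β * ∏ i, s i ^ B i)
    (hP2 : ∀ a b : ℕ, a < p → b < p → (a ≠ 0 ∨ b ≠ 0) → ∀ z : K, z ≠ 0 → v (x ^ a * y ^ b) ≠ v (z ^ p))
    (a b : ℕ) (ha : a < p) (hb : b < p) (hab : a ≠ 0 ∨ b ≠ 0) :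
    ¬ ∀ i, p ∣ a * A i + b * B i := by
  intro hdvd
  choose N hN using hdvd
  -- the `M`-monomial `m := Π s_i^{N_i}`
  set m : K := ∏ i, s i ^ N i with hm
  have hmM : m ∈ M := by
    rw [hm]; exact Subfield.prod_mem M (fun i _ => Subfield.pow_mem M (hsM i) _)
  have hm0 : m ≠ 0 := by
    rw [hm]; exact Finset.prod_ne_zero_iff.mpr (fun i _ => pow_ne_zero _ (hs0 i))
  -- `(x^a y^b)^p = α^a β^b m^p`
  have hpow : (x ^ a * y ^ b) ^ p = α ^ a * β ^ b * m ^ p := by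
    have e1 : (x ^ a * y ^ b) ^ p = (x ^ p) ^ a * (y ^ p) ^ b := by ring
    rw [e1, hx, hy, mul_pow, mul_pow, hm, ← Finset.prod_pow, ← Finset.prod_pow, ← Finset.prod_pow]
    have e2 : (∏ i, (s i ^ A i) ^ a) * ∏ i, (s i ^ B i) ^ b = ∏ i, (s i ^ N i) ^ p := by
      rw [← Finset.prod_mul_distrib]
      refine Finset.prod_congr rfl (fun i _ => ?_)
      rw [← pow_mul, ← pow_mul, ← pow_mul, ← pow_add, mul_comm (A i) a, mul_comm (B i) b, hN i, mul_comm p (N i)]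
    calc α ^ a * (∏ i, (s i ^ A i) ^ a) * (β ^ b * ∏ i, (s i ^ B i) ^ b)
        = α ^ a * β ^ b * ((∏ i, (s i ^ A i) ^ a) * ∏ i, (s i ^ B i) ^ b) := by ring
      _ = α ^ a * β ^ b * ∏ i, (s i ^ N i) ^ p := by rw [e2]
  -- values: `v(x^a y^b)^p = v(m)^p`, hence `v(x^a y^b) = v m = v(z^p)`
  have hval : v (x ^ a * y ^ b) ^ p = v m ^ p := by
    rw [← map_pow, hpow, map_mul, map_mul, map_pow, map_pow, hα, hβ, one_pow, one_pow, one_mul, one_mul, map_pow]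
  have hval' : v (x ^ a * y ^ b) = v m := pow_left_injective_of_ne_zero hp hval
  obtain ⟨z, hz0, hz⟩ := hV m hmM hm0
  exact hP2 a b ha hb hab z hz0 (hval'.trans hz)

end Summit.ResolutionOfSingularities.ResolutionOfSingularities.Cruxes.DescentPerfectToAll.CpSibling.PunchlineBits
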